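import Literature.AnabelianGeometry.SemiGraphs.SemiGraphLocal
import Literature.AnabelianGeometry.SemiGraphs.SubdivisionLemmas

/-!
# Semi-graphs: proofs of the p. 13–14 observations on `G → G̅`, `G[v]`, `G[e]`, `G[b]` ([SemiAnbd] §1)

Mochizuki, *Semi-graphs of Anabelioids*, Publ. RIMS **42** (2006) 221–322, §1, author's manuscript
pp. 13–14 [cite: MochizukiSemiAnbd2006, §1 pp.13-14].  Proof-only companion of `SemiGraphLocal.lean`:
the three NAMED FACTS stated there are discharged here, with no change of statement:

* `toCompactification_isEmbedding_holds` — "Thus, `G` forms a sub-semi-graph of its compactification"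
  (p. 13): `G → G̅` is an embedding (isomorphism onto the sub-semi-graph of old vertices, all edges);
* `compactificationMap_unique_holds` — "any morphism of semi-graphs induces a *unique* morphism
  between the respective compactifications" (p. 13): a new vertex `v_b` must go to the abutment of
  the image of `b`, by compatibility with the coincidence maps;
* `atVertex_atEdge_atBranch_isTree_holds` — "`G[v]`, `G[e]`, `G[b]` are all trees" (p. 13), in the
  rendering of `SemiGraph.lean` (the barycentric subdivision is a connected acyclic simple graph).

Tools: `SubdivisionLemmas.lean` (adjacency of `G.subdivision` made explicit; two acyclicity
criteria — every vertex receives at most one branch, or every edge has at most one abutting branch).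

Deliberately NOT here: anything topological (the paper's trees are contractible spaces; we use the
combinatorial rendering fixed in `SemiGraph.lean`).
-/

namespace Literature.AnabelianGeometry.SemiGraphs

namespace SemiGraph

open CategoryTheory

universe u

variable (G : SemiGraph.{u})

/-! ### `G → G̅` is an embedding (p. 13) -/

/-- DISCHARGE of the named fact `toCompactification_isEmbedding` (p. 13: "Thus, `G` forms a
sub-semi-graph of its compactification"): `G → G̅` is an isomorphism onto the sub-semi-graph of `G̅`
with the old vertices and all the edges. [cite: MochizukiSemiAnbd2006, §1 p.13] -/
theorem toCompactification_isEmbedding_holds : toCompactification_isEmbedding.{u} := by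
  intro G
  let H : G.compactification.Subgraph := ⟨Set.range Sum.inl, Set.univ⟩
  have habuts : ∀ (b : H.toSemiGraph.Branch) (w : H.toSemiGraph.Vertex),
      H.toSemiGraph.abuts b = some w ↔ G.compactification.abuts b.1 = some w.1 :=
    Subgraph.abuts_eq_some_iff H
  refine ⟨H, ⟨⟨fun v => ⟨Sum.inl v, v, rfl⟩, fun e => ⟨e, Set.mem_univ e⟩,
      fun b => ⟨b, Set.mem_univ (G.edgeOf b)⟩, fun _ => rfl, fun _ _ _ h => congrArg Subtype.val h,
      fun b v h => (habuts _ _).mpr (G.compactification_abuts_of_eq_some h)⟩,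
    ⟨fun w => match w with
        | ⟨Sum.inl v, _⟩ => v
        | ⟨Sum.inr _, h⟩ => False.elim (by obtain ⟨v, hv⟩ := h; simp at hv),
      fun e => e.1, fun b => b.1, fun _ => rfl, fun _ _ _ h => Subtype.ext h, ?_⟩, ?_, ?_⟩, ?_⟩
  · -- compatibility of the inverse with the coincidence maps
    rintro b ⟨w, v, rfl⟩ h
    have h' := (habuts _ _).mp h
    cases hb : G.abuts b.1 with
    | none =>
      rw [G.compactification_abuts_of_eq_none hb] at h'
      exact absurd (Option.some.inj h') Sum.inr_ne_inl
    | some v' =>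
      rw [G.compactification_abuts_of_eq_some hb] at h'
      have hvv : v' = v := Sum.inl.inj (Option.some.inj h')
      subst hvv
      rfl
  · rfl
  · refine hom_ext _ _ ?_ rfl rfl
    funext w
    obtain ⟨w, v, rfl⟩ := w
    rfl
  · rfl

/-! ### Uniqueness of the induced morphism of compactifications (p. 13) -/

/-- DISCHARGE of the named fact `compactificationMap_unique` (p. 13: "any morphism of semi-graphs
induces a *unique* morphism between the respective compactifications"): a morphism `ψ : G̅ → G̅'`
extending `φ` agrees with the induced one — on old vertices, edges and branches by hypothesis, and on
a new vertex `v_b` because `v_b` is the abutment of `b`, so `ψ(v_b)` is the abutment of `φ(b)`.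
[cite: MochizukiSemiAnbd2006, §1 p.13] -/
theorem compactificationMap_unique_holds : compactificationMap_unique.{u} := by
  intro G G' φ ψ hψ
  have hv : ∀ v : G.Vertex, ψ.vertexMap (Sum.inl v) = Sum.inl (φ.vertexMap v) := fun v =>
    congrFun (congrArg Hom.vertexMap hψ) v
  have he : ψ.edgeMap = φ.edgeMap := congrArg Hom.edgeMap hψ
  have hb : ψ.branchMap = φ.branchMap := congrArg Hom.branchMap hψ
  refine hom_ext _ _ ?_ he hb
  funext x
  rcases x with v | ⟨b, hb0⟩
  · exact hv v
  · have h1 := ψ.abuts_branchMap b (Sum.inr ⟨b, hb0⟩) (G.compactification_abuts_of_eq_none hb0)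
    have h2 := (compactificationMap φ).abuts_branchMap b (Sum.inr ⟨b, hb0⟩)
      (G.compactification_abuts_of_eq_none hb0)
    have h3 : ψ.branchMap b = (compactificationMap φ).branchMap b := by rw [hb]; rfl
    rw [h3] at h1
    rw [h1] at h2
    exact Option.some_injective _ h2

/-! ### `G[v]`, `G[e]`, `G[b]` are trees (p. 13) -/

/-- `G[v]` is a tree: connected (everything hangs off the unique vertex) and acyclic (each edge
`e'_{b_v}` has exactly one abutting branch). [cite: MochizukiSemiAnbd2006, §1 p.13] -/
theorem atVertex_isTree (v : G.Vertex) : (G.atVertex v).IsTree := by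
  refine ⟨⟨?_, ?_⟩⟩
  · rw [SimpleGraph.connected_iff_exists_forall_reachable]
    refine ⟨Sum.inl PUnit.unit, ?_⟩
    have hedge : ∀ b : (G.atVertex v).Edge,
        (G.atVertex v).subdivision.Reachable (Sum.inl PUnit.unit) (Sum.inr (Sum.inl b)) := by
      intro b
      let p : (G.atVertex v).Branch := ⟨(b, b.1), rfl⟩
      have hp : (G.atVertex v).abuts p = some PUnit.unit :=
        ((G.atVertex_abuts_eq_some_iff v p PUnit.unit).mpr rfl)
      exact (((G.atVertex v).subdivision_reachable_edge_branch p).trans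
        ((G.atVertex v).subdivision_reachable_branch_vertex hp)).symm
    rintro (u | b | p)
    · exact ⟨SimpleGraph.Walk.nil⟩
    · exact hedge b
    · exact (hedge p.1.1).trans ((G.atVertex v).subdivision_reachable_edge_branch p)
  · apply subdivision_isAcyclic_of_vertCard_le_one
    intro p q hpq hp hq
    obtain ⟨u, hu⟩ := Option.isSome_iff_exists.mp hp
    obtain ⟨u', hu'⟩ := Option.isSome_iff_exists.mp hq
    have hp' := (G.atVertex_abuts_eq_some_iff v p u).mp hu
    have hq' := (G.atVertex_abuts_eq_some_iff v q u').mp hu'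
    have h1 : p.1.1 = q.1.1 := hpq
    apply Subtype.ext
    apply Prod.ext h1
    rw [hp', hq', h1]

/-- `G[e]` is a tree: connected (everything hangs off the unique edge) and acyclic (each vertex
`v'_{b_e}` receives exactly one branch). [cite: MochizukiSemiAnbd2006, §1 p.13] -/
theorem atEdge_isTree (e : G.Edge) : (G.atEdge e).IsTree := by
  refine ⟨⟨?_, ?_⟩⟩
  · rw [SimpleGraph.connected_iff_exists_forall_reachable]
    refine ⟨Sum.inr (Sum.inl PUnit.unit), ?_⟩
    rintro (w | u | c)
    · let c : (G.atEdge e).Branch := ⟨w.1, w.2.1⟩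
      have hc : (G.atEdge e).abuts c = some w := (G.atEdge_abuts_eq_some_iff e c w).mpr rfl
      exact ((G.atEdge e).subdivision_reachable_edge_branch c).trans
        ((G.atEdge e).subdivision_reachable_branch_vertex hc)
    · exact ⟨SimpleGraph.Walk.nil⟩
    · exact (G.atEdge e).subdivision_reachable_edge_branch c
  · apply subdivision_isAcyclic_of_star_subsingleton
    intro c₁ c₂ w h₁ h₂
    have h1 := (G.atEdge_abuts_eq_some_iff e c₁ w).mp h₁
    have h2 := (G.atEdge_abuts_eq_some_iff e c₂ w).mp h₂
    exact Subtype.ext (h1.trans h2.symm)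

/-- `G[b]` is a tree: connected and acyclic, as a sub-semi-graph of `G[e_b]` with one vertex
receiving exactly one branch. [cite: MochizukiSemiAnbd2006, §1 p.13] -/
theorem atBranch_isTree (b : G.Branch) (hb : (G.abuts b).isSome) :
    (G.atBranch b hb).toSemiGraph.IsTree := by
  refine ⟨⟨?_, ?_⟩⟩
  · rw [SimpleGraph.connected_iff_exists_forall_reachable]
    let e₀ : (G.atBranch b hb).toSemiGraph.Edge := ⟨PUnit.unit, Set.mem_univ _⟩
    refine ⟨Sum.inr (Sum.inl e₀), ?_⟩
    rintro (w | u | c)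
    · let c : (G.atBranch b hb).toSemiGraph.Branch := ⟨⟨b, rfl⟩, Set.mem_univ _⟩
      have hc : (G.atBranch b hb).toSemiGraph.abuts c = some w :=
        (G.atBranch_abuts_eq_some_iff b hb c w).mpr rfl
      exact ((G.atBranch b hb).toSemiGraph.subdivision_reachable_edge_branch c).trans
        ((G.atBranch b hb).toSemiGraph.subdivision_reachable_branch_vertex hc)
    · exact ⟨SimpleGraph.Walk.nil⟩
    · exact (G.atBranch b hb).toSemiGraph.subdivision_reachable_edge_branch c
  · apply subdivision_isAcyclic_of_star_subsingleton
    intro c₁ c₂ w h₁ h₂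
    have h1 := (G.atBranch_abuts_eq_some_iff b hb c₁ w).mp h₁
    have h2 := (G.atBranch_abuts_eq_some_iff b hb c₂ w).mp h₂
    exact Subtype.ext (Subtype.ext (h1.trans h2.symm))

/-- DISCHARGE of the named fact `atVertex_atEdge_atBranch_isTree` (p. 13: "`G[v]`, `G[e]`, `G[b]`
are all trees [even if `G` fails to be untangled]"). [cite: MochizukiSemiAnbd2006, §1 p.13] -/
theorem atVertex_atEdge_atBranch_isTree_holds : atVertex_atEdge_atBranch_isTree.{u} :=
  fun G => ⟨G.atVertex_isTree, G.atEdge_isTree, G.atBranch_isTree⟩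

end SemiGraph

end Literature.AnabelianGeometry.SemiGraphs
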